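import Summits.ABC.IUTFork.ForkAbc

/-!
# Kernel DAG index — APEX: `ABC` on top of the IUT fork, every undischarged input a named hypothesis (spec §4)

index v1 · abc-iut-c312-2 (filer) per HOME/plan/KERNEL-DAG-SPEC.md v1.1 §4 (ONE WRITER of the spec: abc-iut-dag;
ref-b V2 binding: the full hypothesis triple explicit, no `∃`-family, no bare `VojtaShape`/`Claim6`).

THIS FILE PROVES NOTHING NEW AND ASSERTS NOTHING. `summit_of_cor312` is skel V's
`Summit.ABC.IUTFork.abc_of_indeterminacies_of_cor312` (ForkAbc.lean, in tree) re-stated with NODE NAMES as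
hypotheses, so that the kernel displays what stands between the tree and the summit statement `ABC` on the
IUT route AS FILED TODAY:

* data/structure hypotheses (carry axioms, i.e. are themselves inputs): `V : HeightFamily` (Scholze–Stix §1.2
  (1.2)–(1.3): the family and its height functions), `T : Thm110Family V` (the [IUTchIV] Thm-1.10 numbers of each
  curve + the uniform bounds of [IUTchIV] Cor. 2.2), `A : AbcDictionary V` (the bounded-discrepancy abc
  dictionary; S-layer: to be REPLACED by the landed [GenEll]/[IUTchIV] §2 reductions, whose FACT-policy inputs then
  appear here by name — spec §4 rule (2));
* node hypotheses: `hInd : N_IUTchIII_Thm3_11_MultiradialEstimate T` (skel `MochizukiIndeterminacies` = per curve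
  the multiradial estimate `−|log(Θ)| ≤ C_Θ·|log(q)|` with the printed `C_Θ` — [IUTchIII] Thm 3.11 with
  (Ind1), (Ind2), (Ind3) as read in [IUTchIV] Thm 1.10 Steps (iv)–(x); M-layer: to be replaced by c312-1's
  `Thm311.FullSituation.Statement` + the volume computation D9′ when they land) and
  `h312 : N_IUTchIII_Cor3_12_family T` ([IUTchIII] Cor. 3.12 for every curve; C312-layer: to be replaced by
  `(hThm311 …) (hSteps …) (hEdge : RealEdges …)` through c312-2's chain `Cor312Steps`/`Cor312Chain` and ONE of
  the typed readings of the edge — author / Scholze–Stix / LANA — spec §4 rule (3)).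

KERNEL DISTANCE-TO-SUMMIT (this filing): `kernel_hyps = 2` node hypotheses (`hInd`, `h312`) + 3 structure inputs
(`V`, `T`, `A`). HONEST FRAMING: nothing here asserts that abc is proved or refuted or takes a side on
[IUTchIII] Cor. 3.12; the theorem says exactly "abc follows from these named inputs", no more. typed ≠ discharged;
indexed ≠ endorsed. apex provisional: the per-reading apexes `summit_of_cor312_author/_SS/_LANA` (spec §4 (3))
are filed when `Cor312Chain`/`Cor312EdgeDegrees`/`Cor312EdgeRegions` (c312-2 files IV, V-a, V-b) are in the tree.
-/

namespace Summit.ABC.IUTFork.DAG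

/-- [node (apex input) · the multiradial estimate for every curve of the family — skel `MochizukiIndeterminacies`:
`∀ P, (T.X P).MultiradialEstimate`, i.e. `−|log(Θ)| ≤ C_Θ·|log(q)|` with the printed `C_Θ` ([IUTchIV] Thm 1.10,
Steps (iv)–(x), from [IUTchIII] Thm 3.11 (i)–(iii) with (Ind1), (Ind2), (Ind3)). CLAIM-FORM: a name, no `_holds`.
[claim: Mochizuki2012, status: disputed] -/
abbrev N_IUTchIII_Thm3_11_MultiradialEstimate {V : HeightFamily} (T : Thm110Family V) : Prop :=
  MochizukiIndeterminacies T

/-- [node IUTchIII:Cor3.12, family form · [IUTchIII] Cor. 3.12 for every curve of the family — skel `Cor312 T`: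
`∀ P, (T.X P).Cor312`, i.e. `−|log(q)| ≤ −|log(Θ)|`]. CLAIM-FORM: a name, no `_holds`.
[claim: Mochizuki2012, status: disputed] -/
abbrev N_IUTchIII_Cor3_12_family {V : HeightFamily} (T : Thm110Family V) : Prop :=
  Summit.ABC.IUTFork.Cor312 T

/-- **APEX.** `ABC` (the summit statement, `Summits/ABC/ABC/Statement.lean`) from exactly these named inputs: the
family `V`, its Thm-1.10 data `T`, the abc dictionary `A`, the multiradial estimate for every curve (`hInd`) and
[IUTchIII] Cor. 3.12 for every curve (`h312`) — skel `abc_of_indeterminacies_of_cor312` BY NAME (its content: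
`C_Θ ≥ −1` ⟹ Thm 1.10's display (checked algebra, `l ≥ 7`) ⟹ Claim 6 ⟹ Vojta's height inequality for the
family (checked analysis) ⟹ `ABC` through the dictionary). `kernel_hyps = 2 (hInd, h312)` + inputs `V, T, A`.
[claim: Mochizuki2012, status: disputed] -/
theorem summit_of_cor312 (V : HeightFamily) (T : Thm110Family V) (A : AbcDictionary V)
    (hInd : N_IUTchIII_Thm3_11_MultiradialEstimate T) (h312 : N_IUTchIII_Cor3_12_family T) : _root_.ABC :=
  abc_of_indeterminacies_of_cor312 V T A hInd h312

end Summit.ABC.IUTFork.DAG
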